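import Mathlib
import Summits.Ventures.PercRepro2.Defs
import Summits.Ventures.PercRepro2.Harris
import Summits.Ventures.PercRepro2.Graph
import Summits.Ventures.PercRepro2.Events
import Summits.Ventures.PercRepro2.TReduction
import Summits.Ventures.PercRepro2.TReductionBase

/-!
# The antipodal base-case hypothesis of (T_h) fails on `K_{2,5}` (blind cell PercRepro2, mine-a g48)

`K_{2,5}`: root `r = 0`, hit vertex `h = 1`, five middle vertices `x_i = i + 2`, edge `2i` joining
`r` and `x_i`, edge `2i + 1` joining `x_i` and `h`.  For the up-sets `𝓤 = {x₀, x₁ ∈ T}` and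
`𝓥 = {x₂, x₃, x₄ ∈ T}` of vertex sets and the cell's events `Q = {h ∈ C_r}`, `U = {C_r ∈ 𝓤}`,
`e = {C_r ∈ 𝓥}`, the antipodal base case of `TReductionBase` with every edge free,
`kform Q U e univ a = Σ_σ 1_Q(σ) (1_U(σ) − 1_U(σ̄)) (1_e(σ) − 1_e(σ̄))` (the same for every weight
vector `a`, since nothing is pinned), equals `−3` (`kform_univ_eq`): the hypothesis of the lane's
reduction `TReduction.tform_nonneg_of_base` / `TReductionBase.t_cluster_of_antipodal_base` is
FALSE on `K_{2,5}` (MINE-A.md §103.1, proofs/MINEA-THETA.md §2, where the closed formula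
`x(2^b − 1) + y(2^a − 1) − xy`, `x = 3^a − 2^a`, `y = 3^b − 2^b`, is proved for every `K_{2,k}`).
This does not refute `(T_h)` itself (the weighted form stays positive there); it says that the
base-case route cannot prove it beyond graphs whose minors avoid `K_{2,5}`.

Route: the open cluster of the root is characterised explicitly (`cluster_eq`: `h ∈ C_r` iff some
middle vertex has both edges open; `x_i ∈ C_r` iff its lower edge is open, or `h ∈ C_r` and its
upper edge is open — by the closure lemma `mem_of_conn_of_closed`), the three indicators become
Boolean functions of the configuration, the sum over the `2^10` configurations is unfolded into
ten nested Boolean sums (`sum_pi_succ`) and evaluated by `decide`.  No instance, no notation.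
-/

namespace Summit.Ventures.PercRepro2

namespace KTwoFive

open Finset TReduction

/-- The lower edge of the middle vertex `i`: joins the root and `x_i`. -/
def lo (i : Fin 5) : Fin 10 := ⟨2 * i.val, by omega⟩

/-- The upper edge of the middle vertex `i`: joins `x_i` and the hit vertex. -/
def up (i : Fin 5) : Fin 10 := ⟨2 * i.val + 1, by omega⟩

/-- The middle vertex `x_i = i + 2`. -/
def mid (i : Fin 5) : Fin 7 := ⟨i.val + 2, by omega⟩

/-- The edge map of `K_{2,5}`. -/
def ends : Fin 10 → Sym2 (Fin 7) := fun e =>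
  if e.val % 2 = 0 then s(0, ⟨e.val / 2 + 2, by omega⟩) else s(⟨e.val / 2 + 2, by omega⟩, 1)

/-- `ends` at a lower edge. -/
lemma ends_lo (i : Fin 5) : ends (lo i) = s(0, mid i) := by
  have h1 : (lo i).val % 2 = 0 := by simp [lo]
  have h2 : (⟨(lo i).val / 2 + 2, by omega⟩ : Fin 7) = mid i := by
    apply Fin.ext
    simp only [lo, mid]
    omega
  simp only [ends, h1, if_true, h2]

/-- `ends` at an upper edge. -/
lemma ends_up (i : Fin 5) : ends (up i) = s(mid i, 1) := by
  have h1 : ¬ ((up i).val % 2 = 0) := by simp [up]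
  have h2 : (⟨(up i).val / 2 + 2, by omega⟩ : Fin 7) = mid i := by
    apply Fin.ext
    simp only [up, mid]
    omega
  simp only [ends, h1, if_false, h2]

/-- Every edge is a lower or an upper edge of some middle vertex. -/
lemma edge_cases (e : Fin 10) : (∃ i, e = lo i) ∨ (∃ i, e = up i) := by
  by_cases h : e.val % 2 = 0
  · left
    refine ⟨⟨e.val / 2, by omega⟩, ?_⟩
    ext; simp only [lo]; omega
  · right
    refine ⟨⟨e.val / 2, by omega⟩, ?_⟩
    ext; simp only [up]; omega

/-- The middle vertices are neither the root nor the hit vertex. -/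
lemma mid_ne_zero (i : Fin 5) : mid i ≠ 0 := by
  intro h
  have := congrArg Fin.val h
  change i.val + 2 = 0 at this
  omega

/-- The middle vertices are not the hit vertex. -/
lemma mid_ne_one (i : Fin 5) : mid i ≠ 1 := by
  intro h
  have := congrArg Fin.val h
  change i.val + 2 = 1 at this
  omega

/-- `mid` is injective. -/
lemma mid_injective : Function.Injective mid := by
  intro i j h
  have := congrArg Fin.val h
  change i.val + 2 = j.val + 2 at this
  exact Fin.ext (by omega)

/-- The Boolean hit predicate: some middle vertex has both of its edges open. -/
def hitB (ω : Config (Fin 10)) : Bool := ω 0 && ω 1 || ω 2 && ω 3 || ω 4 && ω 5 || ω 6 && ω 7 || ω 8 && ω 9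

/-- `hitB` holds when some middle vertex has both edges open. -/
lemma hitB_of {ω : Config (Fin 10)} {i : Fin 5} (hlo : ω (lo i) = true) (hup : ω (up i) = true) :
    hitB ω = true := by
  unfold hitB
  fin_cases i <;> simp_all [lo, up]

/-- `hitB` yields a middle vertex with both edges open. -/
lemma exists_of_hitB {ω : Config (Fin 10)} (h : hitB ω = true) :
    ∃ i, ω (lo i) = true ∧ ω (up i) = true := by
  unfold hitB at h
  simp only [Bool.or_eq_true, Bool.and_eq_true] at h
  rcases h with (((⟨h0, h1⟩ | ⟨h2, h3⟩) | ⟨h4, h5⟩) | ⟨h6, h7⟩) | ⟨h8, h9⟩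
  · exact ⟨0, h0, h1⟩
  · exact ⟨1, h2, h3⟩
  · exact ⟨2, h4, h5⟩
  · exact ⟨3, h6, h7⟩
  · exact ⟨4, h8, h9⟩

/-- The explicit cluster of the root: the root, the middle vertices with an open lower edge, and —
when the hit predicate holds — the hit vertex and the middle vertices with an open upper edge. -/
def clusterSet (ω : Config (Fin 10)) : Set (Fin 7) :=
  {v | v = 0 ∨ (∃ i, v = mid i ∧ (ω (lo i) = true ∨ (hitB ω = true ∧ ω (up i) = true)))
    ∨ (v = 1 ∧ hitB ω = true)}

/-- The explicit set is closed under open adjacency. -/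
lemma clusterSet_closed (ω : Config (Fin 10)) :
    ∀ x ∈ clusterSet ω, ∀ y, (openGraph ends ω).Adj x y → y ∈ clusterSet ω := by
  intro x hx y hxy
  obtain ⟨-, e, he, hends⟩ := openGraph_adj.1 hxy
  rcases edge_cases e with ⟨i, rfl⟩ | ⟨i, rfl⟩
  · -- lower edge of `i`: endpoints the root and `x_i`
    rw [ends_lo] at hends
    rcases Sym2.eq_iff.1 hends with ⟨rfl, rfl⟩ | ⟨rfl, rfl⟩
    · exact Or.inr (Or.inl ⟨i, rfl, Or.inl he⟩)
    · exact Or.inl rfl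
  · -- upper edge of `i`: endpoints `x_i` and the hit vertex
    rw [ends_up] at hends
    rcases Sym2.eq_iff.1 hends with ⟨rfl, rfl⟩ | ⟨rfl, rfl⟩
    · -- from `x_i` (in the set) to the hit vertex
      rcases hx with h0 | ⟨j, hj, hj'⟩ | ⟨h1, _⟩
      · exact absurd h0 (mid_ne_zero i)
      · have hij : j = i := mid_injective hj.symm
        subst hij
        rcases hj' with hlo | ⟨hhit, _⟩
        · exact Or.inr (Or.inr ⟨rfl, hitB_of hlo he⟩)
        · exact Or.inr (Or.inr ⟨rfl, hhit⟩)
      · exact absurd h1 (mid_ne_one i)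
    · -- from the hit vertex (in the set, so `Hit`) to `x_i`
      rcases hx with h0 | ⟨j, hj, -⟩ | ⟨-, hhit⟩
      · exact absurd h0 (by decide)
      · exact absurd hj.symm (mid_ne_one j)
      · exact Or.inr (Or.inl ⟨i, rfl, Or.inr ⟨hhit, he⟩⟩)

/-- Open adjacency along a lower edge. -/
lemma openAdj_lo {ω : Config (Fin 10)} {i : Fin 5} (h : ω (lo i) = true) :
    OpenAdj ends ω 0 (mid i) := ⟨lo i, h, ends_lo i⟩

/-- Open adjacency along an upper edge. -/
lemma openAdj_up {ω : Config (Fin 10)} {i : Fin 5} (h : ω (up i) = true) :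
    OpenAdj ends ω (mid i) 1 := ⟨up i, h, ends_up i⟩

/-- Under `hitB`, the hit vertex is connected to the root. -/
lemma conn_one_of_hit {ω : Config (Fin 10)} (h : hitB ω = true) : Conn ends ω 0 1 := by
  obtain ⟨i, hlo, hup⟩ := exists_of_hitB h
  exact conn_trans (conn_of_openAdj (openAdj_lo hlo)) (conn_of_openAdj (openAdj_up hup))

/-- **The cluster of the root of `K_{2,5}`** is the explicit set. -/
theorem cluster_eq (ω : Config (Fin 10)) : cluster ends ω 0 = clusterSet ω := by
  apply Set.Subset.antisymm
  · intro v hv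
    exact mem_of_conn_of_closed (clusterSet_closed ω) (Or.inl rfl) hv
  · intro v hv
    rcases hv with rfl | ⟨i, rfl, hlo | ⟨hhit, hup⟩⟩ | ⟨rfl, hhit⟩
    · exact mem_cluster_self ends ω 0
    · exact conn_of_openAdj (openAdj_lo hlo)
    · exact conn_trans (conn_one_of_hit hhit) (conn_symm (conn_of_openAdj (openAdj_up hup)))
    · exact conn_one_of_hit hhit

/-- The Boolean membership of the middle vertex `i` in the cluster of the root. -/
def midB (ω : Config (Fin 10)) (i : Fin 5) : Bool := ω (lo i) || (hitB ω && ω (up i))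

/-- Membership of the hit vertex in the cluster. -/
lemma one_mem_iff (ω : Config (Fin 10)) : (1 : Fin 7) ∈ cluster ends ω 0 ↔ hitB ω = true := by
  rw [cluster_eq]
  constructor
  · rintro (h | ⟨i, hi, -⟩ | ⟨-, h⟩)
    · exact absurd h (by decide)
    · exact absurd hi.symm (mid_ne_one i)
    · exact h
  · intro h
    exact Or.inr (Or.inr ⟨rfl, h⟩)

/-- Membership of a middle vertex in the cluster. -/
lemma mid_mem_iff (ω : Config (Fin 10)) (i : Fin 5) :
    mid i ∈ cluster ends ω 0 ↔ midB ω i = true := by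
  rw [cluster_eq]
  unfold midB
  simp only [Bool.or_eq_true, Bool.and_eq_true]
  constructor
  · rintro (h | ⟨j, hj, hj'⟩ | ⟨h, -⟩)
    · exact absurd h (mid_ne_zero i)
    · have : j = i := mid_injective hj.symm
      subst this
      exact hj'
    · exact absurd h (mid_ne_one i)
  · intro h
    exact Or.inr (Or.inl ⟨i, rfl, h⟩)

/-- The up-set `𝓤 = {x₀, x₁ ∈ T}`. -/
def 𝓤 : Set (Set (Fin 7)) := {T | mid 0 ∈ T ∧ mid 1 ∈ T}

/-- The up-set `𝓥 = {x₂, x₃, x₄ ∈ T}`. -/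
def 𝓥 : Set (Set (Fin 7)) := {T | mid 2 ∈ T ∧ mid 3 ∈ T ∧ mid 4 ∈ T}

/-- `𝓤` is an up-set. -/
lemma isUpperSet_𝓤 : IsUpperSet 𝓤 := fun _ _ h hT => ⟨h hT.1, h hT.2⟩

/-- `𝓥` is an up-set. -/
lemma isUpperSet_𝓥 : IsUpperSet 𝓥 := fun _ _ h hT => ⟨h hT.1, h hT.2.1, h hT.2.2⟩

/-- The Boolean indicator of `U`. -/
def uB (ω : Config (Fin 10)) : Bool := midB ω 0 && midB ω 1

/-- The Boolean indicator of `e`. -/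
def eB (ω : Config (Fin 10)) : Bool := midB ω 2 && midB ω 3 && midB ω 4

/-- The event `U = {C_r ∈ 𝓤}` is decided by `uB`. -/
lemma mem_U_iff (ω : Config (Fin 10)) : ω ∈ clusterInEvent ends 0 𝓤 ↔ uB ω = true := by
  rw [mem_clusterInEvent]
  unfold 𝓤 uB
  simp only [Set.mem_setOf_eq, Bool.and_eq_true, mid_mem_iff]

/-- The event `e = {C_r ∈ 𝓥}` is decided by `eB`. -/
lemma mem_e_iff (ω : Config (Fin 10)) : ω ∈ clusterInEvent ends 0 𝓥 ↔ eB ω = true := by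
  rw [mem_clusterInEvent]
  unfold 𝓥 eB
  simp only [Set.mem_setOf_eq, Bool.and_eq_true, mid_mem_iff, and_assoc]

/-- The hit event `Q = {h ∈ C_r}` is decided by `hitB`. -/
lemma mem_Q_iff (ω : Config (Fin 10)) :
    ω ∈ clusterInEvent ends 0 {T : Set (Fin 7) | (1 : Fin 7) ∈ T} ↔ hitB ω = true := by
  rw [mem_clusterInEvent, Set.mem_setOf_eq, one_mem_iff]

section Sum

variable {R : Type*} [CommRing R]

/-- An indicator decided by a Boolean predicate is the cast of the integer `if`. -/
lemma indicator_eq_of_iff {A : Set (Config (Fin 10))} {b : Config (Fin 10) → Bool}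
    (h : ∀ ω, ω ∈ A ↔ b ω = true) (ω : Config (Fin 10)) :
    A.indicator (fun _ => (1 : R)) ω = ((if b ω then (1 : ℤ) else 0 : ℤ) : R) := by
  by_cases hb : b ω = true
  · rw [Set.indicator_of_mem ((h ω).2 hb), if_pos hb]; simp
  · rw [Set.indicator_of_notMem (fun hc => hb ((h ω).1 hc)), if_neg hb]; simp

/-- The integer antipodal term at a configuration. -/
def term (ω : Config (Fin 10)) : ℤ :=
  (if hitB ω then (1 : ℤ) else 0)
    * ((if uB ω then (1 : ℤ) else 0) - (if uB (fun x => !ω x) then (1 : ℤ) else 0))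
    * ((if eB ω then (1 : ℤ) else 0) - (if eB (fun x => !ω x) then (1 : ℤ) else 0))

/-- A sum over the configurations of `n + 1` edges splits along the first edge. -/
lemma sum_pi_succ (n : ℕ) (g : (Fin (n + 1) → Bool) → ℤ) :
    ∑ ω, g ω = ∑ b : Bool, ∑ ω : Fin n → Bool, g (Fin.cons b ω) := by
  rw [← Equiv.sum_comp (Fin.consEquiv fun _ => Bool) g, Fintype.sum_prod_type]
  rfl

/-- **The antipodal sum of `K_{2,5}` at `(𝓤, 𝓥)` is `−3`.** -/
lemma sum_term : ∑ ω : Config (Fin 10), term ω = -3 := by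
  show ∑ ω : Fin 10 → Bool, term ω = -3
  simp only [sum_pi_succ]
  decide

end Sum

section Main

variable {R : Type*} [Field R] [LinearOrder R] [IsStrictOrderedRing R]

omit [IsStrictOrderedRing R] in
/-- **The base-case hypothesis fails on `K_{2,5}`**: with every edge free (`D = univ`, so the
weight vector `a` plays no role), `K_univ(a) = −3 < 0` for `Q = {h ∈ C_r}`, `U = {C_r ∈ 𝓤}`,
`e = {C_r ∈ 𝓥}`. -/
theorem kform_univ_eq (a : Fin 10 → R) :
    kform (clusterInEvent ends 0 {T : Set (Fin 7) | (1 : Fin 7) ∈ T}) (clusterInEvent ends 0 𝓤)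
      (clusterInEvent ends 0 𝓥) Finset.univ a = -3 := by
  classical
  rw [kform_eq_antipodal_sum _ _ _ (fun x hx => absurd (mem_univ x) hx)]
  have hsupp : suppOn (Finset.univ : Finset (Fin 10)) = Finset.univ := by
    ext σ
    simp only [mem_suppOn, mem_univ, not_true_eq_false, false_imp_iff, implies_true]
  have hbase : ∀ σ : Config (Fin 10), baseConfig a Finset.univ σ = σ := by
    intro σ
    funext x
    simp [baseConfig]
  rw [hsupp]
  have hterm : ∀ σ : Config (Fin 10),
      (clusterInEvent ends 0 {T : Set (Fin 7) | (1 : Fin 7) ∈ T}).indicator (fun _ => (1 : R))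
          (baseConfig a Finset.univ σ)
        * ((clusterInEvent ends 0 𝓤).indicator (fun _ => (1 : R)) (baseConfig a Finset.univ σ)
            - (clusterInEvent ends 0 𝓤).indicator (fun _ => (1 : R))
                (baseConfig a Finset.univ fun x => !σ x))
        * ((clusterInEvent ends 0 𝓥).indicator (fun _ => (1 : R)) (baseConfig a Finset.univ σ)
            - (clusterInEvent ends 0 𝓥).indicator (fun _ => (1 : R))
                (baseConfig a Finset.univ fun x => !σ x)) = ((term σ : ℤ) : R) := by
    intro σ
    rw [hbase, hbase, indicator_eq_of_iff mem_Q_iff, indicator_eq_of_iff mem_U_iff,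
      indicator_eq_of_iff mem_U_iff, indicator_eq_of_iff mem_e_iff, indicator_eq_of_iff mem_e_iff]
    unfold term
    push_cast
    ring
  rw [sum_congr rfl fun σ _ => hterm σ, ← Int.cast_sum, sum_term]
  norm_num

/-- The hypothesis of `tform_nonneg_of_base` is violated on `K_{2,5}`. -/
theorem not_base_nonneg :
    ¬ ∀ (D : Finset (Fin 10)) (a : Fin 10 → R), IsProbVec a →
      (∀ x, x ∉ D → a x = 0 ∨ a x = 1) →
      0 ≤ kform (clusterInEvent ends 0 {T : Set (Fin 7) | (1 : Fin 7) ∈ T})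
        (clusterInEvent ends 0 𝓤) (clusterInEvent ends 0 𝓥) D a := by
  intro h
  have := h Finset.univ (fun _ => 0) ⟨fun _ => le_rfl, fun _ => zero_le_one⟩
    (fun x hx => absurd (mem_univ x) hx)
  rw [kform_univ_eq] at this
  linarith

end Main

end KTwoFive

end Summit.Ventures.PercRepro2
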